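import Summits.QuantumFields.BalabanUV.Beta.D1BFx.LamGroupPointwise
import Summits.QuantumFields.BalabanUV.Beta.D1BFx.LamSectorUnfold
import Summits.QuantumFields.BalabanUV.Beta.D1BFx.FrozenLegProfile
import Summits.QuantumFields.BalabanUV.Beta.D1BFx.BlockSumTranspose
import Summits.QuantumFields.BalabanUV.Beta.D1BFx.Assembly
import Summits.QuantumFields.BalabanUV.Beta.D1BFx.LamFactor

/-!
# `BalabanUV.Beta.D1BFx.LamDictionary` — road «BF-x» for binder row D1, slot (K), census group **G_Λ**: THE Λ-DICTIONARY
# (an3-g53 LAMBDA-DICTIONARY v1 (DICT), owner «LAM-DICT» BRICK 2b, ruling ρ-g9-18): the END's G_Λ row IS `LamWord ν Nrν + LamWord μ Nrμ`,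
# the two instances of the left side of `LamCoeffMoments.blockAvg_M2_lamCoeffOf_eq_zero_of_zeroMomentum` consumed by `LamRowGlue.gLam_row_eq_zero_of_dict`

HONEST DEPENDENCY (page 1, mandatory): continuum YM on T⁴ ⇐ BetaPertH ∧ nine spine estimates (0/9 proved); BetaPertH ⇐ (D1) ∧ (D4) ∧
CAP+tail; G-an2-4 gates asym, D1 and NE2/3/4.  HONEST FRAMING (cell contract, verbatim): «discharging `BetaPertH` makes Bałaban's UV
stability UNCONDITIONAL — a real constructive-QFT result; it is NOT the continuum limit and NOT the Clay problem.»  THIS MODULE DISCHARGES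
NOTHING of the wall: TWO definitions with a body ([our object] the PARTNER FUNCTIONALS `Nrν`, `Nrμ` of an3-g53 §4 — data) and [folklore]
`tsum` bookkeeping BY NAME over BRICK 1 `LamGroupPointwise.sum_lamFibre_restK'`, BRICK 2a `LamSectorUnfold.bubble_SbL_left∕right`∕`tadpole_lamTable_eq`,
`WindowIdentification.fullSum_eq_tsum_sub`, `Assembly.sum_image_resSite`, `BlockSumTranspose.sum_box_toSite_eq_sum_resSite`∕`tsum_shift_base`∕
`sum_resSite_tsum_transpose`, `LamFactor.summable_word_of_decay`.  No `Prop` minted, nothing cited, no hypothesis is a printed statement, 0 sorry.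
NO letter (the zero-momentum letter `hZero` stays (W1)+(W2′)+`KernelWardInsertionZero.tsum_resp_eq_zero`), NO bound, NO estimate: the Λ₂-slot
structure and the partner functionals' localisation∕covariance letters (an3 §6 (C)(D), the SAME letters `LamRowGlue` displays) are DISPLAYED
HYPOTHESES.  0 wall binders; (K) NOT closed; NOT D1, NOT `BetaPertH`, NOT continuum, NOT Clay.

ABSOLUTE RULE (cell charter, verbatim): «No internally-minted statement may enter as a cited fact. Every hypothesis is either kernel-proved in
this package or a verbatim quotation of a PUBLISHED theorem with page reference. The manuscript(s) under audit are NOT citable for their own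
disputed steps — they are the thing under adjudication; programme-internal (2001/route/tribunal) claims are never citable.»

CONTENT (`Λ′ m y κ u := lamCoeffOf (KInv (N := n) (d := 3)) n m y κ u`, `Y m y := ffOf (hessFF n m y)`, `G := Ga n a`, `S_full := SbfBal n a cE cVH cΛ cR cK cQ`).
* §1 [our object] **`Nrν`** (partner of a Λ′ sitting at the BASE bond `(ν, b)`: `ωgl·n⁻⁸·(cΛ·½·bubble G ((S_full − cΛ•SbL n) μ u′) (Y m y) + cΛ₂·½·tadpole G (TΛ m y μ u′))`)
  and **`Nrμ`** (partner of a Λ′ sitting at the RUNNING bond `(μ, ·)`: `ωgl·n⁻⁸·(cΛ·½·bubble G (Y m y) (S_full ν u′) + cΛ₂·½·tadpole G (TΛ m y ν u′))`).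
* §2 [folklore] summability plumbing; **`lamGroup_pointwise`**: at a base site `b` and displacement `w`, for any exponentially bounded profile,
  `Σ_{τ ∈ lamFibre} restK' … b τ w = w_μ·w_ν·( Σ_m Σ'_y Λ′ m y ν b · Nrν m y (b+w) + Σ_m Σ'_y Λ′ m y μ (b+w) · Nrμ m y b )`.
* §3 [folklore] **`gLam_row_eq_lamWords`** — THE DICTIONARY: the END's G_Λ row (base-point average over `univ.image resSite` of `n⁻⁴·fullSum` of the group,
  frozen profile `gfrz n a b`, index set `univ.filter (grp · = gΛ) = lamFibre`) EQUALS `LamRowGlue.gLam_row_eq_zero_of_dict`'s `hdict` right side at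
  `(N, d) := (n, 3)`, token for token.
Unit `b2b-balaban-gan24-formalise-leaf-05` (gen 40), G-an2-4 swarm leaf prover on cross-lane kernel duty for road «BF-x» (owner d1-p2).
-/

noncomputable section

namespace Summit.QuantumFields.BalabanUV.Beta.D1BFx.LamDictionary

open Finset Filter Topology
open scoped BigOperators
open Literature.MathematicalPhysics.QuantumFieldTheory
open Literature.MathematicalPhysics.QuantumFieldTheory.Balaban1983to89
open Literature.MathematicalPhysics.QuantumFieldTheory.Balaban1983to89.Beta
open B12Sec2to5 (l1 l1_nonneg)
open ExpKernelCalculus (Site MKer Decays BiLoc bubble tadpole abs_tadpole_le summable_exp_shift' Zl Zl_nonneg)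
open DyadicShell (Pt toReal toReal_apply)
open WindowIdentification (fullSum fullSum_eq_tsum_sub)
open DressedMomentNormalisation (resSite)
open AffineAveraging (box toSite)
open OneStepResolventKernel (Fib KInv)
open InterLevelTransport (onLat onLat_zsmul)
open BalabanStepJets (lamCoeffOf lamCoeffOf_translate)
open OneStepResolventKernel (shiftK_KInv)
open AveragingHessianKernels (hessFF biLoc_hessFF)
open Summit.QuantumFields.BalabanUV.Beta.TameKernelCalculus (Spr Loc trK biLoc_of_le decays_of_le)
open Summit.QuantumFields.BalabanUV.Beta.D1BFx.PackedKernelSplit (bubble_eq_biBubble)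
open Summit.QuantumFields.BalabanUV.Beta.D1BFx.FineStencilBF (ffOf biLoc_ffOf)
open Summit.QuantumFields.BalabanUV.Beta.D1BFx.GluonLeg (Ga)
open Summit.QuantumFields.BalabanUV.Beta.D1BFx.ReducedKernel (TableR)
open Summit.QuantumFields.BalabanUV.Beta.D1BFx.DressedTadpoleTable (tadpoleTable_apply)
open Summit.QuantumFields.BalabanUV.Beta.D1BFx.FineStencilBFBalaban (SbfBal exists_biLoc_SbfBal)
open Summit.QuantumFields.BalabanUV.Beta.D1BFx.GluonKernelSectors (SbL exists_biLoc_SbL)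
open Summit.QuantumFields.BalabanUV.Beta.D1BFx.FineHessianSectors (biBubbleTable_apply)
open Summit.QuantumFields.BalabanUV.Beta.D1BFx.FrozenLegProfile (gfrz decay_gfrz)
open Summit.QuantumFields.BalabanUV.Beta.D1BFx.SplitInstance (RestIdx)
open Summit.QuantumFields.BalabanUV.Beta.D1BFx.SplitRecut (restK')
open Summit.QuantumFields.BalabanUV.Beta.D1BFx.Assembly (sum_image_resSite)
open Summit.QuantumFields.BalabanUV.Beta.D1BFx.BlockSumTranspose (sum_box_toSite_eq_sum_resSite tsum_shift_base sum_resSite_tsum_transpose)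
open Summit.QuantumFields.BalabanUV.Beta.D1BFx.LamGroupPointwise (lamFibre sum_lamFibre_restK')
open Summit.QuantumFields.BalabanUV.Beta.D1BFx.LamSectorUnfold (exists_abs_lamCoeff_KInv_le bubble_SbL_left bubble_SbL_right tadpole_lamTable_eq
  biLoc_onLat)

/-! ## §1 The two partner functionals of an3-g53 §4 -/

section Defs

variable (n : ℕ) [NeZero n] (a cE cVH cΛ cR cK cQ cΛ₂ ωgl : ℝ) (TΛ : Fin 4 → Site 4 → Fin 4 → Site 4 → MKer 4 (Fin 4))

/-- [our object] **THE PARTNER OF A Λ′ SITTING AT THE BASE BOND `(ν, b)`** (an3-g53 §4 `Nrν`): the μ-side partner stencil `S_full − cΛ•SbL n` at the running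
site against the Λ-companion `Y m y = ffOf (hessFF n m y)` in the fine bubble, plus the Λ₂-companion tadpole; weights `ωgl`, `n⁻⁸`, `cΛ`, `cΛ₂`, `½` folded in.
A DEFINITION (data); asserts nothing. -/
def Nrν (μ : Fin 4) (m : Fin 4) (y u' : Site 4) : ℝ :=
  ωgl * (((n : ℝ) ^ 8)⁻¹ * (cΛ * ((1 / 2 : ℝ) * bubble (Ga n a) (SbfBal n a cE cVH cΛ cR cK cQ μ u' - cΛ • SbL n μ u') (ffOf (hessFF n m y)))
    + cΛ₂ * ((1 / 2 : ℝ) * tadpole (Ga n a) (TΛ m y μ u'))))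

/-- [our object] **THE PARTNER OF A Λ′ SITTING AT THE RUNNING BOND `(μ, ·)`** (an3-g53 §4 `Nrμ`): the Λ-companion against the ν-side FULL stencil at `u′`, plus
the Λ₂-companion tadpole.  A DEFINITION (data); asserts nothing. -/
def Nrμ (ν : Fin 4) (m : Fin 4) (y u' : Site 4) : ℝ :=
  ωgl * (((n : ℝ) ^ 8)⁻¹ * (cΛ * ((1 / 2 : ℝ) * bubble (Ga n a) (ffOf (hessFF n m y)) (SbfBal n a cE cVH cΛ cR cK cQ ν u'))
    + cΛ₂ * ((1 / 2 : ℝ) * tadpole (Ga n a) (TΛ m y ν u'))))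

end Defs

/-! ## §2 Summability plumbing and the pointwise identity -/

section Pointwise

variable (n : ℕ) [NeZero n] {a : ℝ} (cE cVH cΛ cR cK cQ cE₂ cJ4 cΛ₂ cR₂ cQ₂ x₀ : ℝ) (WE WJ WΛ WR WQ : TableR) (ωgl ωgh lam N : ℝ)
  {TΛ WA : Fin 4 → Site 4 → Fin 4 → Site 4 → MKer 4 (Fin 4)} {CT δT : ℝ}

/-- [folklore] Coarse block positions are summable against a weight decaying in fine units (`y ↦ n•y` is injective). -/
theorem summable_exp_zsmul {c : ℝ} (hc : 0 < c) (p : Site 4) : Summable fun y : Site 4 => Real.exp (-c * l1 ((n : ℤ) • y - p)) := by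
  have hN : (n : ℤ) ≠ 0 := by exact_mod_cast NeZero.ne n
  have hinj : Function.Injective fun y : Site 4 => (n : ℤ) • y := smul_right_injective _ hN
  exact (summable_exp_shift' hc p).comp_injective hinj

/-- [folklore] The road's Λ′ against a uniformly bounded scalar family is summable over the coarse bond position. -/
theorem summable_lam_mul_of_bdd {F : Site 4 → ℝ} {B : ℝ} (hF : ∀ y, |F y| ≤ B) (m κ : Fin 4) (u : Site 4) :
    Summable fun y : Site 4 => lamCoeffOf (KInv (N := n) (d := 3)) n m y κ u * F y := by
  obtain ⟨C, δ, hC, hδ, hw⟩ := exists_abs_lamCoeff_KInv_le n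
  have hB : 0 ≤ B := (abs_nonneg _).trans (hF 0)
  refine Summable.of_norm_bounded ((summable_exp_zsmul n hδ u).mul_left (C * B)) fun y => ?_
  rw [Real.norm_eq_abs, abs_mul]
  calc |lamCoeffOf (KInv (N := n) (d := 3)) n m y κ u| * |F y| ≤ (C * Real.exp (-δ * l1 ((n : ℤ) • y - u))) * B :=
        mul_le_mul (hw m y κ u) (hF y) (abs_nonneg _) (by positivity)
    _ = C * B * Real.exp (-δ * l1 ((n : ℤ) • y - u)) := by ring

/-- [folklore] The Λ-companions `Y m y`, extended by zero over the fine lattice, are bi-localised at their fine index (one constant for all `m`). -/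
theorem exists_biLoc_onLat_Y {δ : ℝ} (hδ : 0 ≤ δ) :
    ∃ CY : ℝ, ∀ (m : Fin 4) (v : Site 4), BiLoc (onLat n (fun y => ffOf (hessFF n m y)) v) v v CY δ := by
  have hn : 1 ≤ n := NeZero.one_le
  have hY := fun (m : Fin 4) (y : Site 4) => biLoc_ffOf (biLoc_hessFF (d := 3) hn m y hδ)
  exact ⟨_, fun m v => biLoc_onLat n ((hY m 0).nonneg (0 : Fin 4)) (hY m) v⟩

/-- [folklore] The Λ-companion bubbles against a bond-localised stencil family are UNIFORMLY BOUNDED in the coarse position (both slot orders). -/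
theorem exists_bubble_Y_bound (hGa : Spr (Ga n a)) {S : Fin 4 → Site 4 → MKer 4 (Fin 4)} {Cs δs : ℝ} (hδs : 0 < δs)
    (hS : ∀ κ u, BiLoc (S κ u) u u Cs δs) (m κ : Fin 4) (u : Site 4) :
    ∃ B : ℝ, (∀ y : Site 4, |bubble (Ga n a) (S κ u) (ffOf (hessFF n m y))| ≤ B) ∧
      ∀ y : Site 4, |bubble (Ga n a) (ffOf (hessFF n m y)) (S κ u)| ≤ B := by
  obtain ⟨CY, hY⟩ := exists_biLoc_onLat_Y n hδs.le
  obtain ⟨B₁, -, h₁⟩ := DressedBubbleBridge.exists_bubble_bound (S := fun u => S κ u) hGa (fun u => hS κ u) (hY m) hδs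
  obtain ⟨B₂, -, h₂⟩ := DressedBubbleBridge.exists_bubble_bound (S' := fun u => S κ u) hGa (hY m) (fun u => hS κ u) hδs
  refine ⟨max B₁ B₂, fun y => ?_, fun y => ?_⟩
  · have h := h₁ u ((n : ℤ) • y)
    rw [onLat_zsmul] at h
    exact h.trans (le_max_left _ _)
  · have h := h₂ ((n : ℤ) • y) u
    rw [onLat_zsmul] at h
    exact h.trans (le_max_right _ _)

/-- [folklore] The Λ₂-companion tadpoles are UNIFORMLY BOUNDED in the coarse position (the socket's amplitude decay dropped). -/
theorem exists_tadpole_T_bound (hGa : Spr (Ga n a)) (hδT : 0 < δT)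
    (hTloc : ∀ m y κ u, BiLoc (TΛ m y κ u) ((n : ℤ) • y) ((n : ℤ) • y) (CT * Real.exp (-δT * l1 ((n : ℤ) • y - u))) δT)
    (m κ : Fin 4) (u : Site 4) : ∃ B : ℝ, ∀ y : Site 4, |tadpole (Ga n a) (TΛ m y κ u)| ≤ B := by
  have hCT : 0 ≤ CT := by
    have h := (hTloc 0 0 0 0).nonneg (0 : Fin 4)
    have hpos : (0 : ℝ) < Real.exp (-δT * l1 ((n : ℤ) • (0 : Site 4) - 0)) := Real.exp_pos _
    nlinarith
  have hT : ∀ y : Site 4, BiLoc (TΛ m y κ u) ((n : ℤ) • y) ((n : ℤ) • y) CT δT := by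
    intro y x z a b
    refine (hTloc m y κ u x z a b).trans (mul_le_mul_of_nonneg_right ?_ (Real.exp_pos _).le)
    exact mul_le_of_le_one_right hCT (Real.exp_le_one_iff.2 (by nlinarith [l1_nonneg ((n : ℤ) • y - u)]))
  obtain ⟨CA, δA, hδA, hAd⟩ := hGa
  set m₀ : ℝ := min δA δT with hm₀
  have hδ₀ : 0 < m₀ := lt_min hδA hδT
  have hA : Decays (Ga n a) (|CA|) m₀ := decays_of_le hAd (min_le_left _ _)
  have hZ1 : 0 ≤ Zl 4 (m₀ - m₀ / 2) := Zl_nonneg (by linarith)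
  have hZ2 : 0 ≤ Zl 4 (m₀ / 2 / 2) := Zl_nonneg (by linarith)
  refine ⟨(Fintype.card (Fin 4) : ℝ) * ((Fintype.card (Fin 4) : ℝ) * (|CA| * |CT|) * Zl 4 (m₀ - m₀ / 2)) * Zl 4 (m₀ / 2 / 2), fun y => ?_⟩
  refine (abs_tadpole_le hA (biLoc_of_le (hT y) (min_le_right _ _)) hδ₀).trans ?_
  exact mul_le_of_le_one_right (by positivity) (Real.exp_le_one_iff.2 (by nlinarith [l1_nonneg ((n : ℤ) • y - (n : ℤ) • y)]))

variable (a)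

/-- [folklore] **THE POINTWISE IDENTITY** (an3-g53 (GΛ)+(Λ-1)(Λ-2)(Λ-T) assembled): at a base site `b` and displacement `w`, for ANY exponentially
bounded profile `g`, `0 < a`, `Spr (Ga n a)`, the Λ₂ slot bi-localised (`hΛ`) and carrying the DISPLAYED Λ₂ structure (`hdec`, `hTloc`, `hWAa`, `hWAl`):
`Σ_{τ ∈ lamFibre} restK' … b τ w = w_μ·w_ν·( Σ_m Σ'_y Λ′ m y ν b · Nrν m y (b+w) + Σ_m Σ'_y Λ′ m y μ (b+w) · Nrμ m y b )`. -/
theorem lamGroup_pointwise (ha : 0 < a) (hGa : Spr (Ga n a)) {g : Pt → ℝ} {C δ : ℝ} (hδ : 0 < δ) (hg : ∀ v, |g v| ≤ C * Real.exp (-δ * l1 v))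
    {CΛt δW : ℝ} (hδW : 0 < δW) (hΛ : ∀ κ u l u', BiLoc (WΛ κ u l u') u u' CΛt δW) (hδT : 0 < δT)
    (hdec : ∀ κ u l u', WΛ κ u l u' =
      (∑ m : Fin 4, OneStepResolventKernel.wsum (onLat n (fun y => lamCoeffOf (KInv (N := n) (d := 3)) n m y l u'))
          (fun v => onLat n (fun y => TΛ m y κ u) v))
      + (∑ m : Fin 4, OneStepResolventKernel.wsum (onLat n (fun y => lamCoeffOf (KInv (N := n) (d := 3)) n m y κ u))
          (fun v => onLat n (fun y => TΛ m y l u') v))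
      + WA κ u l u')
    (hTloc : ∀ m y κ u, BiLoc (TΛ m y κ u) ((n : ℤ) • y) ((n : ℤ) • y) (CT * Real.exp (-δT * l1 ((n : ℤ) • y - u))) δT)
    (hWAa : ∀ κ u l u', trK (WA κ u l u') = -WA κ u l u') (hWAl : ∀ κ u l u', Loc (WA κ u l u'))
    (μ ν : Fin 4) (b w : Pt) :
    ∑ τ ∈ lamFibre, restK' n a g cE cΛ cR cK cQ cE₂ cJ4 cΛ₂ cR₂ cQ₂ x₀ WE WJ WΛ WR WQ ωgl ωgh lam N μ ν b τ w
      = toReal w μ * toReal w ν *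
        ((∑ m : Fin 4, ∑' y : Site 4, lamCoeffOf (KInv (N := n) (d := 3)) n m y ν b * Nrν n a cE cVH cΛ cR cK cQ cΛ₂ ωgl TΛ μ m y (b + w))
        + ∑ m : Fin 4, ∑' y : Site 4, lamCoeffOf (KInv (N := n) (d := 3)) n m y μ (b + w) * Nrμ n a cE cVH cΛ cR cK cQ cΛ₂ ωgl TΛ ν m y b) := by
  -- localisation of the two partner stencils
  obtain ⟨Cf, δf, hδf, hSf⟩ := exists_biLoc_SbfBal n a ha cE cVH cΛ cR cK cQ
  obtain ⟨Cl, δl, hδl, hSl⟩ := exists_biLoc_SbL n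
  have hδm : 0 < min δf δl := lt_min hδf hδl
  have hSμ : ∀ (κ : Fin 4) (u : Site 4), BiLoc (SbfBal n a cE cVH cΛ cR cK cQ κ u - cΛ • SbL n κ u) u u (|Cf| + |cΛ| * |Cl|) (min δf δl) :=
    fun κ u => KernelWard.biLoc_sub (biLoc_of_le (hSf κ u) (min_le_left _ _))
      (StepJetData.biLoc_smul (biLoc_of_le (hSl κ u) (min_le_right _ _)) cΛ)
  have hLf : Loc (SbfBal n a cE cVH cΛ cR cK cQ ν b) := ⟨b, b, Cf, δf, hδf, hSf ν b⟩
  have hLμ : Loc (SbfBal n a cE cVH cΛ cR cK cQ μ (b + w) - cΛ • SbL n μ (b + w)) := ⟨b + w, b + w, _, _, hδm, hSμ μ (b + w)⟩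
  -- BRICK 1 at (b, w), then BRICK 2a in each of the three words
  rw [sum_lamFibre_restK' n a cE cVH cΛ cR cK cQ cE₂ cJ4 cΛ₂ cR₂ cQ₂ x₀ WE WJ WΛ WR WQ ωgl ωgh lam N μ ν b ha hGa hδ hg hδW hΛ w,
    biBubbleTable_apply, biBubbleTable_apply, ← bubble_eq_biBubble, ← bubble_eq_biBubble, tadpoleTable_apply,
    bubble_SbL_left n hGa hLf μ (b + w), bubble_SbL_right n hGa hLμ ν b,
    tadpole_lamTable_eq n ha hGa hδT hdec hTloc hWAa hWAl μ (b + w) ν b]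
  -- the four coarse families are bounded, hence summable against Λ′; fold each partner functional
  have eν : ∀ m : Fin 4,
      (∑' y : Site 4, lamCoeffOf (KInv (N := n) (d := 3)) n m y ν b * Nrν n a cE cVH cΛ cR cK cQ cΛ₂ ωgl TΛ μ m y (b + w))
        = ωgl * (((n : ℝ) ^ 8)⁻¹ * (cΛ * (1 / 2 : ℝ))) *
            (∑' y : Site 4, lamCoeffOf (KInv (N := n) (d := 3)) n m y ν b *
              bubble (Ga n a) (SbfBal n a cE cVH cΛ cR cK cQ μ (b + w) - cΛ • SbL n μ (b + w)) (ffOf (hessFF n m y)))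
          + ωgl * (((n : ℝ) ^ 8)⁻¹ * (cΛ₂ * (1 / 2 : ℝ))) *
            (∑' y : Site 4, lamCoeffOf (KInv (N := n) (d := 3)) n m y ν b * tadpole (Ga n a) (TΛ m y μ (b + w))) := by
    intro m
    obtain ⟨B₂, hB₂, -⟩ := exists_bubble_Y_bound n hGa hδm hSμ m μ (b + w)
    obtain ⟨BT, hBT⟩ := exists_tadpole_T_bound n hGa hδT hTloc m μ (b + w)
    rw [← tsum_mul_left, ← tsum_mul_left, ← ((summable_lam_mul_of_bdd n hB₂ m ν b).mul_left _).tsum_add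
      ((summable_lam_mul_of_bdd n hBT m ν b).mul_left _)]
    exact tsum_congr fun y => by simp only [Nrν]; ring
  have eμ : ∀ m : Fin 4,
      (∑' y : Site 4, lamCoeffOf (KInv (N := n) (d := 3)) n m y μ (b + w) * Nrμ n a cE cVH cΛ cR cK cQ cΛ₂ ωgl TΛ ν m y b)
        = ωgl * (((n : ℝ) ^ 8)⁻¹ * (cΛ * (1 / 2 : ℝ))) *
            (∑' y : Site 4, lamCoeffOf (KInv (N := n) (d := 3)) n m y μ (b + w) *
              bubble (Ga n a) (ffOf (hessFF n m y)) (SbfBal n a cE cVH cΛ cR cK cQ ν b))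
          + ωgl * (((n : ℝ) ^ 8)⁻¹ * (cΛ₂ * (1 / 2 : ℝ))) *
            (∑' y : Site 4, lamCoeffOf (KInv (N := n) (d := 3)) n m y μ (b + w) * tadpole (Ga n a) (TΛ m y ν b)) := by
    intro m
    obtain ⟨B₁, -, hB₁⟩ := exists_bubble_Y_bound n hGa hδf hSf m ν b
    obtain ⟨BT, hBT⟩ := exists_tadpole_T_bound n hGa hδT hTloc m ν b
    rw [← tsum_mul_left, ← tsum_mul_left, ← ((summable_lam_mul_of_bdd n hB₁ m μ (b + w)).mul_left _).tsum_add
      ((summable_lam_mul_of_bdd n hBT m μ (b + w)).mul_left _)]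
    exact tsum_congr fun y => by simp only [Nrμ]; ring
  simp only [eν, eμ, Finset.sum_add_distrib, ← Finset.mul_sum]
  ring

end Pointwise

/-! ## §3 Summability of the two words, periodicity of the running word, and THE DICTIONARY -/

section Assembly

variable (n : ℕ) [NeZero n] {a : ℝ} (cE cVH cΛ cR cK cQ cE₂ cJ4 cΛ₂ cR₂ cQ₂ x₀ : ℝ) (WE WJ WΛ WR WQ : TableR) (ωgl ωgh lam N : ℝ)
  {TΛ WA : Fin 4 → Site 4 → Fin 4 → Site 4 → MKer 4 (Fin 4)} {CT δT : ℝ} (μ ν : Fin 4)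

/-- [folklore] The quadrupole weight is even. -/
theorem weight_even (z : Pt) : (((-z) μ : ℤ) : ℝ) * (((-z) ν : ℤ) : ℝ) = ((z μ : ℤ) : ℝ) * ((z ν : ℤ) : ℝ) := by
  simp only [Pi.neg_apply, Int.cast_neg, neg_mul_neg]

/-- [folklore] **SUMMABILITY OF A Λ′-AT-THE-BASE WORD** along the running site: Λ′ at the base bond `(κ, b)`, an exponentially localised block family
`Nr` at the running site `b + w`, quadrupole weight (`LamFactor.summable_word_of_decay`, one Fubini). -/
theorem summable_word_base {Nr : Fin 4 → Site 4 → Site 4 → ℝ} {C' δ' : ℝ} (hδ' : 0 < δ')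
    (hNr : ∀ m y u, |Nr m y u| ≤ C' * Real.exp (-δ' * l1 ((n : ℤ) • y - u))) (κ : Fin 4) (b : Pt) :
    Summable fun w : Pt => ((w μ : ℤ) : ℝ) * ((w ν : ℤ) : ℝ) *
      ∑ m : Fin 4, ∑' y : Site 4, lamCoeffOf (KInv (N := n) (d := 3)) n m y κ b * Nr m y (b + w) := by
  obtain ⟨CL, δL, -, hδL, hL⟩ := exists_abs_lamCoeff_KInv_le n
  have hp : ∀ z : Site 4, |(fun z : Site 4 => ((z μ : ℤ) : ℝ) * ((z ν : ℤ) : ℝ)) z| ≤ 1 * (1 + l1 z) ^ 2 :=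
    fun z => (LamFactor.abs_weights_le z μ ν 0).2.2
  have hS : ∀ m : Fin 4, Summable fun u' : Site 4 => ∑' y : Site 4,
      ((((u' - b) μ : ℤ) : ℝ) * (((u' - b) ν : ℤ) : ℝ)) * (lamCoeffOf (KInv (N := n) (d := 3)) n m y κ b * Nr m y u') := fun m =>
    (LamFactor.summable_word_of_decay n (Λ := fun m y u => lamCoeffOf (KInv (N := n) (d := 3)) n m y κ u) (Nr := Nr)
      (p := fun z : Site 4 => ((z μ : ℤ) : ℝ) * ((z ν : ℤ) : ℝ)) hp hδL hδ' m (fun y u => hL m y κ u) (hNr m) b).prod_symm.prod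
  refine ((summable_sum fun m (_ : m ∈ (univ : Finset (Fin 4))) => hS m).comp_injective (add_right_injective b)).congr fun w => ?_
  simp only [Function.comp_def, add_sub_cancel_left, tsum_mul_left, ← Finset.mul_sum]

/-- [folklore] **SUMMABILITY OF A Λ′-AT-THE-RUNNING-SITE WORD**: Λ′ at the running bond `(κ, b + w)`, the block family at the base `b` (the roles of the two decaying
factors exchanged in `summable_word_of_decay`). -/
theorem summable_word_run {Nr : Fin 4 → Site 4 → Site 4 → ℝ} {C' δ' : ℝ} (hδ' : 0 < δ')
    (hNr : ∀ m y u, |Nr m y u| ≤ C' * Real.exp (-δ' * l1 ((n : ℤ) • y - u))) (κ : Fin 4) (b : Pt) :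
    Summable fun w : Pt => ((w μ : ℤ) : ℝ) * ((w ν : ℤ) : ℝ) *
      ∑ m : Fin 4, ∑' y : Site 4, lamCoeffOf (KInv (N := n) (d := 3)) n m y κ (b + w) * Nr m y b := by
  obtain ⟨CL, δL, -, hδL, hL⟩ := exists_abs_lamCoeff_KInv_le n
  have hp : ∀ z : Site 4, |(fun z : Site 4 => ((z μ : ℤ) : ℝ) * ((z ν : ℤ) : ℝ)) z| ≤ 1 * (1 + l1 z) ^ 2 :=
    fun z => (LamFactor.abs_weights_le z μ ν 0).2.2
  have hS : ∀ m : Fin 4, Summable fun u' : Site 4 => ∑' y : Site 4,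
      ((((u' - b) μ : ℤ) : ℝ) * (((u' - b) ν : ℤ) : ℝ)) * (Nr m y b * lamCoeffOf (KInv (N := n) (d := 3)) n m y κ u') := fun m =>
    (LamFactor.summable_word_of_decay n (Λ := Nr) (Nr := fun m y u => lamCoeffOf (KInv (N := n) (d := 3)) n m y κ u)
      (p := fun z : Site 4 => ((z μ : ℤ) : ℝ) * ((z ν : ℤ) : ℝ)) hp hδ' hδL m (hNr m) (fun y u => hL m y κ u) b).prod_symm.prod
  refine ((summable_sum fun m (_ : m ∈ (univ : Finset (Fin 4))) => hS m).comp_injective (add_right_injective b)).congr fun w => ?_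
  simp only [Function.comp_def, add_sub_cancel_left, tsum_mul_left, ← Finset.mul_sum, mul_comm (Nr _ _ b)]

/-- [folklore] **JOINT BLOCK PERIODICITY OF THE RUNNING WORD**: with Λ′ block-covariant (`lamCoeffOf_translate` at `shiftK_KInv`) and the block family covariant
(`hcov`), `Φ u v := Σ_m Σ'_y Λ′ m y κ u · Nr m y v` satisfies `Φ (u + n•t) (v + n•t) = Φ u v`. -/
theorem word_periodic {Nr : Fin 4 → Site 4 → Site 4 → ℝ} (hcov : ∀ m y t u', Nr m (y + t) (u' + (n : ℤ) • t) = Nr m y u') (κ : Fin 4)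
    (u v t : Pt) :
    (∑ m : Fin 4, ∑' y : Site 4, lamCoeffOf (KInv (N := n) (d := 3)) n m y κ (u + (n : ℤ) • t) * Nr m y (v + (n : ℤ) • t))
      = ∑ m : Fin 4, ∑' y : Site 4, lamCoeffOf (KInv (N := n) (d := 3)) n m y κ u * Nr m y v := by
  refine Finset.sum_congr rfl fun m _ => ?_
  rw [← (Equiv.addRight t).tsum_eq (fun y => lamCoeffOf (KInv (N := n) (d := 3)) n m y κ (u + (n : ℤ) • t) * Nr m y (v + (n : ℤ) • t))]
  refine tsum_congr fun y => ?_
  simp only [Equiv.coe_addRight]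
  rw [lamCoeffOf_translate (fun t => shiftK_KInv (N := n) (d := 3) t) m y κ u t, hcov m y t v]

/-- [folklore] **ASSEMBLY OF A BASE WORD** ((S-BLOCK) + the shift of the running site): for any two-point function `Φ`,
`Σ_{b ∈ univ.image resSite} c·Σ'_w w_μ w_ν·Φ b (b+w) = c·Σ_{b ∈ box 4 n} Σ'_{u′} (u′−b)_μ (u′−b)_ν·Φ (toSite b) u′`. -/
theorem base_word_eq (c : ℝ) (Φ : Pt → Pt → ℝ) :
    (∑ b ∈ (univ : Finset (Fin 4 → Fin n)).image resSite, c * ∑' w : Pt, ((w μ : ℤ) : ℝ) * ((w ν : ℤ) : ℝ) * Φ b (b + w))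
      = c * ∑ b ∈ box 4 n, ∑' u' : Pt, (((u' - toSite b) μ : ℤ) : ℝ) * (((u' - toSite b) ν : ℤ) : ℝ) * Φ (toSite b) u' := by
  have h := sum_box_toSite_eq_sum_resSite (N := n) (d := 4)
    (fun s : Pt => ∑' u' : Pt, (((u' - s) μ : ℤ) : ℝ) * (((u' - s) ν : ℤ) : ℝ) * Φ s u')
  beta_reduce at h
  rw [sum_image_resSite, h, Finset.mul_sum]
  refine Finset.sum_congr rfl fun r _ => ?_
  rw [tsum_shift_base (fun z : Pt => ((z μ : ℤ) : ℝ) * ((z ν : ℤ) : ℝ)) (fun u' => Φ (resSite r) u') (resSite r)]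

/-- [folklore] **ASSEMBLY OF A RUNNING WORD** (shift back to the base-indexed form, then (S-TRANSP), then (S-BLOCK)): for a jointly `n`-block-periodic `Φ`
whose two readings are summable per base,
`Σ_{b ∈ univ.image resSite} c·Σ'_w w_μ w_ν·Φ (b+w) b = c·Σ_{b ∈ box 4 n} Σ'_{u′} (u′−b)_μ (u′−b)_ν·Φ (toSite b) u′`. -/
theorem run_word_eq (c : ℝ) (Φ : Pt → Pt → ℝ) (hΦ : ∀ u v t : Pt, Φ (u + (n : ℤ) • t) (v + (n : ℤ) • t) = Φ u v)
    (hS₁ : ∀ r : Fin 4 → Fin n, Summable fun w : Pt => ((w μ : ℤ) : ℝ) * ((w ν : ℤ) : ℝ) * Φ (resSite r + w) (resSite r))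
    (hS₂ : ∀ r : Fin 4 → Fin n, Summable fun w : Pt => ((w μ : ℤ) : ℝ) * ((w ν : ℤ) : ℝ) * Φ (resSite r) (resSite r + w)) :
    (∑ b ∈ (univ : Finset (Fin 4 → Fin n)).image resSite, c * ∑' w : Pt, ((w μ : ℤ) : ℝ) * ((w ν : ℤ) : ℝ) * Φ (b + w) b)
      = c * ∑ b ∈ box 4 n, ∑' u' : Pt, (((u' - toSite b) μ : ℤ) : ℝ) * (((u' - toSite b) ν : ℤ) : ℝ) * Φ (toSite b) u' := by
  have h := sum_box_toSite_eq_sum_resSite (N := n) (d := 4)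
    (fun s : Pt => ∑' u' : Pt, (((u' - s) μ : ℤ) : ℝ) * (((u' - s) ν : ℤ) : ℝ) * Φ s u')
  beta_reduce at h
  have hT := sum_resSite_tsum_transpose (d := 4) (N := n) (NeZero.pos n) Φ (fun z : Pt => ((z μ : ℤ) : ℝ) * ((z ν : ℤ) : ℝ)) hΦ
    (fun z => weight_even μ ν z) hS₁ hS₂
  beta_reduce at hT
  rw [sum_image_resSite, h, ← Finset.mul_sum, ← hT]
  congr 1
  refine Finset.sum_congr rfl fun r _ => ?_
  exact (tsum_shift_base (fun z : Pt => ((z μ : ℤ) : ℝ) * ((z ν : ℤ) : ℝ)) (fun u' => Φ u' (resSite r)) (resSite r)).symm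

variable (a)

/-- [folklore] **THE Λ-DICTIONARY** (an3-g53 LAMBDA-DICTIONARY v1 (DICT); owner ruling ρ-g9-18 BRICK 2b).  For the END of record's data at one block size
`n` — `0 < a`, `Spr (Ga n a)`, the Λ₂-slot socket `hΛ` — the DISPLAYED Λ₂-slot structure (`hdec`, `hTloc`, `hWAa`, `hWAl`; an3 §5), the partner
functionals' DISPLAYED letters (localisation `hNrν`∕`hNrμ` and block covariance `hcovμ`; an3 §6 (C)(D) — the same letters `LamRowGlue.gLam_row_eq_zero_of_dict`
consumes), and an index label whose `gΛ`-fibre is the Λ-group (`hfib`, e.g. the owner's `grp` with `gΛ = 1`):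
THE END's G_Λ ROW — `Σ_{b ∈ univ.image resSite} n⁻⁴·fullSum (w ↦ Σ_{τ : grp τ = gΛ} restK' n a (gfrz n a b) … τ w)` — EQUALS
`n⁻⁴·Σ_{b ∈ box 4 n} Σ'_{u′} (u′−b)_μ (u′−b)_ν · Σ_m Σ'_y Λ′ m y ν (toSite b)·Nrν m y u′ + n⁻⁴·Σ_{b ∈ box 4 n} Σ'_{u′} (u′−b)_μ (u′−b)_ν · Σ_m Σ'_y Λ′ m y μ (toSite b)·Nrμ m y u′`
— `LamRowGlue`'s `hdict` right side at `(N, d) := (n, 3)`.  Steps: BRICK 1 + 2a pointwise (`lamGroup_pointwise`), `fullSum → tsum` (the integrand vanishes at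
`w = 0`), (S-BLOCK) + `tsum_shift_base` for the base word, (S-TRANSP) for the running word. -/
theorem gLam_row_eq_lamWords (ha : 0 < a) (hGa : Spr (Ga n a)) {CΛt δW : ℝ} (hδW : 0 < δW) (hΛ : ∀ κ u l u', BiLoc (WΛ κ u l u') u u' CΛt δW)
    (hδT : 0 < δT)
    (hdec : ∀ κ u l u', WΛ κ u l u' =
      (∑ m : Fin 4, OneStepResolventKernel.wsum (onLat n (fun y => lamCoeffOf (KInv (N := n) (d := 3)) n m y l u'))
          (fun v => onLat n (fun y => TΛ m y κ u) v))
      + (∑ m : Fin 4, OneStepResolventKernel.wsum (onLat n (fun y => lamCoeffOf (KInv (N := n) (d := 3)) n m y κ u))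
          (fun v => onLat n (fun y => TΛ m y l u') v))
      + WA κ u l u')
    (hTloc : ∀ m y κ u, BiLoc (TΛ m y κ u) ((n : ℤ) • y) ((n : ℤ) • y) (CT * Real.exp (-δT * l1 ((n : ℤ) • y - u))) δT)
    (hWAa : ∀ κ u l u', trK (WA κ u l u') = -WA κ u l u') (hWAl : ∀ κ u l u', Loc (WA κ u l u'))
    {Cν δν Cμ δμ : ℝ} (hδν : 0 < δν) (hδμ : 0 < δμ)
    (hNrν : ∀ m y u, |Nrν n a cE cVH cΛ cR cK cQ cΛ₂ ωgl TΛ μ m y u| ≤ Cν * Real.exp (-δν * l1 ((n : ℤ) • y - u)))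
    (hNrμ : ∀ m y u, |Nrμ n a cE cVH cΛ cR cK cQ cΛ₂ ωgl TΛ ν m y u| ≤ Cμ * Real.exp (-δμ * l1 ((n : ℤ) • y - u)))
    (hcovμ : ∀ m y t u', Nrμ n a cE cVH cΛ cR cK cQ cΛ₂ ωgl TΛ ν m (y + t) (u' + (n : ℤ) • t) = Nrμ n a cE cVH cΛ cR cK cQ cΛ₂ ωgl TΛ ν m y u')
    {G : Type*} [Fintype G] [DecidableEq G] {grp : RestIdx → G} {gΛ : G}
    (hfib : (univ : Finset RestIdx).filter (fun τ => grp τ = gΛ) = lamFibre) :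
    ∑ b ∈ (univ : Finset (Fin 4 → Fin n)).image resSite, ((n : ℝ) ^ 4)⁻¹ *
        fullSum (fun w : Pt => ∑ τ ∈ (univ : Finset RestIdx).filter (fun τ => grp τ = gΛ),
          restK' n a (gfrz n a b) cE cΛ cR cK cQ cE₂ cJ4 cΛ₂ cR₂ cQ₂ x₀ WE WJ WΛ WR WQ ωgl ωgh lam N μ ν b τ w)
      = ((n : ℝ) ^ (3 + 1))⁻¹ * ∑ b ∈ box (3 + 1) n, ∑' u', ((((u' - toSite b) μ : ℤ) : ℝ) * (((u' - toSite b) ν : ℤ) : ℝ))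
            * (∑ m, ∑' y, lamCoeffOf (KInv (N := n) (d := 3)) n m y ν (toSite b) * Nrν n a cE cVH cΛ cR cK cQ cΛ₂ ωgl TΛ μ m y u')
        + ((n : ℝ) ^ (3 + 1))⁻¹ * ∑ b ∈ box (3 + 1) n, ∑' u', ((((u' - toSite b) μ : ℤ) : ℝ) * (((u' - toSite b) ν : ℤ) : ℝ))
            * (∑ m, ∑' y, lamCoeffOf (KInv (N := n) (d := 3)) n m y μ (toSite b) * Nrμ n a cE cVH cΛ cR cK cQ cΛ₂ ωgl TΛ ν m y u') := by
  have hn : 0 < n := NeZero.pos n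
  -- the two words at a base site, as functions of the displacement
  have hSν := fun b : Pt => summable_word_base n μ ν hδν hNrν ν b
  have hSμ := fun b : Pt => summable_word_run n μ ν hδμ hNrμ μ b
  -- per base site: the group's full lattice sum is the sum of the two words' lattice sums
  have hbase : ∀ b : Pt,
      fullSum (fun w : Pt => ∑ τ ∈ lamFibre,
          restK' n a (gfrz n a b) cE cΛ cR cK cQ cE₂ cJ4 cΛ₂ cR₂ cQ₂ x₀ WE WJ WΛ WR WQ ωgl ωgh lam N μ ν b τ w)
        = (∑' w : Pt, ((w μ : ℤ) : ℝ) * ((w ν : ℤ) : ℝ) *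
            ∑ m : Fin 4, ∑' y : Site 4, lamCoeffOf (KInv (N := n) (d := 3)) n m y ν b * Nrν n a cE cVH cΛ cR cK cQ cΛ₂ ωgl TΛ μ m y (b + w))
          + ∑' w : Pt, ((w μ : ℤ) : ℝ) * ((w ν : ℤ) : ℝ) *
            ∑ m : Fin 4, ∑' y : Site 4, lamCoeffOf (KInv (N := n) (d := 3)) n m y μ (b + w) * Nrμ n a cE cVH cΛ cR cK cQ cΛ₂ ωgl TΛ ν m y b := by
    intro b
    obtain ⟨C', δ', hδ', hgb⟩ := decay_gfrz (n := n) (a := a) hGa b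
    have e : (fun w : Pt => ∑ τ ∈ lamFibre,
        restK' n a (gfrz n a b) cE cΛ cR cK cQ cE₂ cJ4 cΛ₂ cR₂ cQ₂ x₀ WE WJ WΛ WR WQ ωgl ωgh lam N μ ν b τ w)
        = fun w : Pt => ((w μ : ℤ) : ℝ) * ((w ν : ℤ) : ℝ) *
            (∑ m : Fin 4, ∑' y : Site 4, lamCoeffOf (KInv (N := n) (d := 3)) n m y ν b * Nrν n a cE cVH cΛ cR cK cQ cΛ₂ ωgl TΛ μ m y (b + w))
          + ((w μ : ℤ) : ℝ) * ((w ν : ℤ) : ℝ) *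
            ∑ m : Fin 4, ∑' y : Site 4, lamCoeffOf (KInv (N := n) (d := 3)) n m y μ (b + w) * Nrμ n a cE cVH cΛ cR cK cQ cΛ₂ ωgl TΛ ν m y b := by
      funext w
      rw [lamGroup_pointwise n a cE cVH cΛ cR cK cQ cE₂ cJ4 cΛ₂ cR₂ cQ₂ x₀ WE WJ WΛ WR WQ ωgl ωgh lam N ha hGa hδ' hgb hδW hΛ hδT hdec hTloc
        hWAa hWAl μ ν b w, toReal_apply, toReal_apply, mul_add]
    rw [e, fullSum_eq_tsum_sub _ ((hSν b).add (hSμ b)), ((hSν b)).tsum_add (hSμ b)]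
    simp only [Pi.zero_apply, Int.cast_zero, zero_mul, add_zero, sub_zero]
  rw [hfib, sum_congr rfl fun b _ => by rw [hbase b]]
  simp only [mul_add, sum_add_distrib]
  show _ = ((n : ℝ) ^ 4)⁻¹ * (∑ b ∈ box 4 n, _) + ((n : ℝ) ^ 4)⁻¹ * (∑ b ∈ box 4 n, _)
  congr 1
  · -- the base word
    exact base_word_eq n μ ν _ (fun u v => ∑ m : Fin 4, ∑' y : Site 4,
      lamCoeffOf (KInv (N := n) (d := 3)) n m y ν u * Nrν n a cE cVH cΛ cR cK cQ cΛ₂ ωgl TΛ μ m y v)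
  · -- the running word
    exact run_word_eq n μ ν _ (fun u v => ∑ m : Fin 4, ∑' y : Site 4,
      lamCoeffOf (KInv (N := n) (d := 3)) n m y μ u * Nrμ n a cE cVH cΛ cR cK cQ cΛ₂ ωgl TΛ ν m y v)
      (fun u v t => word_periodic n hcovμ μ u v t) (fun r => hSμ (resSite r)) (fun r => summable_word_base n μ ν hδμ hNrμ μ (resSite r))

end Assembly

end Summit.QuantumFields.BalabanUV.Beta.D1BFx.LamDictionary

end
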